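import Literature.MathematicalPhysics.QuantumManyBody.PeriodicBoseGasSector
import HarnessLib

/-!
# Fournais 2020, §2: the projections `Pᵢ, Qᵢ`, the pairing form `A₂`, and Lemmas 2.3–2.4

Topic `Literature/MathematicalPhysics/QuantumManyBody`, sibling of `PeriodicBoseGasSector.lean`
(provefact `Literature.MathematicalPhysics.QuantumManyBody.BoseGas.Fournais2020_condensation`). The `n`-particle bound
[Fournais2020, (2.43)–(2.46)] (`Fournais2020_eq243`, to which `Fournais2020_thm21` and hence
`Fournais2020_condensation` are reduced, `PeriodicBoseGasThm21.lean`,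
`PeriodicBoseGasReduction.lean`) is, in the paper, the sum of two inequalities on the
`n`-particle sector `L²(Λⁿ)` in which the pairing term `A₂` cancels:

* (2.25), the form of **Lemma 2.3** ("[FournaisSolovej2020, Lemma B.2]": the algebraic
  potential-energy decomposition of Lemma 2.2 followed by Cauchy–Schwarz) used in the proof:
  `-ρ_μ∑ᵢ∫w₁(xᵢ,y)dy + ½∑_{i≠j}w(xᵢ,xⱼ) ≥ A₂ + (n²/(2ℓ³))(8πa + ∫gω) - (ρ_μn/ℓ³ + ¼(ρ_μ - n/ℓ³)²)8πaℓ³ - Ca(ρ_μ + nℓ⁻³)(n₊ + 1)`;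
* (2.26), **Lemma 2.4** (second quantisation (2.27)–(2.42), a Bogoliubov-type completion of
  the square in the operators `b_k = ℓ^{-3/2}a₀†a(Qχ_Λe^{-ikx})`, which preserve the particle
  number): `∑ᵢ(T^{(i)} - bℓ⁻²Qᵢ) + A₂ ≥ -(n(n+1)/(2ℓ³))∫gω - Ca((n₀+1)/ℓ³)n₊ - Cnaℓ⁻³(1 + a²(n+1)²/ℓ² + (n+1)R²/ℓ²)`.

This file vendors both as named facts (`Fournais2020_eq225`, `Fournais2020_lemma24`) together
with the objects they need beyond `PeriodicBoseGasSector.lean`: the projections `Pᵢ`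
(box average in the `i`-th particle) and `Qᵢ = 1 - Pᵢ` (2.5) acting on `n`-body functions
(`nbodyP`, `nbodyQ`), the quadratic form of `A₂ = ½∑_{i≠j}PᵢPⱼw₁(xᵢ,xⱼ)QⱼQᵢ + h.c.` (2.24)
(`a2Form`, real-valued: `A₂` has no sign), and `∫gω` (`gOmegaIntegral`, (2.10)). The deduction
of (2.43) from them (add, cancel `A₂`, (2.44)) is left to a proofs file.

## Rendering

* `(PᵢΦ)(X) = ℓ⁻³∫_Λ Φ(X; xᵢ = y) dy`, `(QᵢΦ)(X) = Φ(X) - (PᵢΦ)(X)` on `Λ(u)ⁿ` ("`P` is the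
  orthogonal projection in `L²(Λ)` onto the constant functions and `Q` the projection to the
  orthogonal complement" (2.5), acting on the `i`-th particle (2.15)); `PᵢPⱼ`, `QⱼQᵢ` are the
  composites.
* `⟨Φ, A₂Φ⟩ = ½∑_{i≠j}(⟨Φ, PᵢPⱼw₁QⱼQᵢΦ⟩ + c.c.) = ∑_{i≠j} Re ∫_{Λⁿ} conj(PᵢPⱼΦ) w₁(xᵢ,xⱼ) QⱼQᵢΦ`
  (`Pᵢ` self-adjoint; `w₁ = pairLoc₁` real, here through `toReal`), a real number (Bochner
  integral; the facts below assume the forms of `Φ` finite, under which the integrand is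
  integrable).
* As `A₂` is signed, (2.25) and (2.26) are vendored as real inequalities between the `toReal`s
  of the `ℝ≥0∞`-valued forms of `PeriodicBoseGasBox.lean`/`PeriodicBoseGasSector.lean`, under
  the hypotheses that these are finite (the operator inequalities restricted to the form
  domain). In (2.26) the printed `-Ca((n₀+1)/ℓ³)n₊` is weakened to `-Ca((n+1)/ℓ³)n₊`
  (`n₀ ≤ n`; this is how it enters (2.45)), which avoids the spectral decomposition of `n₀`.
* Constants, weakest reading: `C` and the smallness `c₁` of `R/ℓ` (for
  `0 ≤ W₁ ≤ (1 + C(R/ℓ)²)g` and the well-definedness of `W`, (2.42)) after `v, ω, χ, R` — and,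
  for Lemma 2.4, after `s` (the momentum splitting at `|p| ≍ s⁻¹ℓ⁻¹`, (2.37), (2.41)) — but
  before `b` (which cancels in `T - bℓ⁻²Q = Qχ_Λ[-Δ - s⁻²ℓ⁻²]₊χ_ΛQ`), `ℓ`, `ρ_μ`, `n`, `u`, `Φ`.

## References

* [Fournais2020] S. Fournais, *Length scales for BEC in the dilute Bose gas*, arXiv:2011.00309,
  EMS Ser. Congr. Rep. 18 (2021), doi:10.4171/ecr/18-1/7: (2.5), (2.10), (2.15), Lemmas 2.2–2.4,
  (2.16)–(2.26), (2.43)–(2.46).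
* [FournaisSolovej2020] S. Fournais, J. P. Solovej, *The energy of dilute Bose gases*,
  Ann. of Math. 192 (2020) 893–976: Lemma B.2.
-/

noncomputable section

open MeasureTheory
open scoped ENNReal NNReal ComplexConjugate

namespace Literature.MathematicalPhysics.QuantumManyBody.BoseGas

/-! ### The projections `Pᵢ`, `Qᵢ` on `n`-body functions (2.5), (2.15) -/

/-- `(PᵢΦ)(X) = ℓ⁻³ ∫_{Λ(u)} Φ(x₁,…,x_{i-1},y,x_{i+1},…) dy`: the projection `P = ℓ⁻³|1⟩⟨1|` of
`L²(Λ)` onto the constants (2.5), acting on the `i`-th particle (2.15) (the value does not depend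
on `xᵢ`). [cite: Fournais2020, (2.5), (2.15)] -/
def nbodyP {n : ℕ} (ℓ : ℝ) (u : Space) (i : Fin n) (Φ : Config n → ℂ) (X : Config n) : ℂ :=
  ((ℓ ^ 3)⁻¹ : ℝ) • ∫ y in slidingBox ℓ u, Φ (Function.update X i y)

/-- `(QᵢΦ)(X) = Φ(X) - (PᵢΦ)(X)`: `Q = 1 - P` (2.5) acting on the `i`-th particle, on `Λ(u)ⁿ`.
[cite: Fournais2020, (2.5), (2.15)] -/
def nbodyQ {n : ℕ} (ℓ : ℝ) (u : Space) (i : Fin n) (Φ : Config n → ℂ) (X : Config n) : ℂ :=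
  Φ X - nbodyP ℓ u i Φ X

/-! ### The pairing form `A₂` (2.24) and `∫gω` (2.10) -/

/-- `⟨Φ, A₂Φ⟩` for `A₂ = ½∑_{i≠j} PᵢPⱼ w₁(xᵢ,xⱼ) QⱼQᵢ + h.c.` (2.24) on `L²(Λ(u)ⁿ)`:
`∑_{i≠j} Re ∫_{Λⁿ} conj((PᵢPⱼΦ)(X)) w₁(xᵢ,xⱼ) (QⱼQᵢΦ)(X) dX` (`Pᵢ` is self-adjoint and `w₁`
real, so `⟨Φ, PᵢPⱼw₁QⱼQᵢΦ⟩ + c.c. = 2Re⟨PᵢPⱼΦ, w₁QⱼQᵢΦ⟩`). A real number (signed).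
[cite: Fournais2020, (2.24)] -/
def a2Form {n : ℕ} (v : ℝ → ℝ≥0∞) (ω : Space → ℝ) (χ : Space → ℝ) (ℓ : ℝ) (u : Space)
    (Φ : Config n → ℂ) : ℝ :=
  ∑ i : Fin n, ∑ j : Fin n with j ≠ i,
    (∫ X in boxConfig n ℓ u, conj (nbodyP ℓ u i (nbodyP ℓ u j Φ) X) *
      ((pairLoc₁ v ω χ ℓ u (X i) (X j)).toReal : ℂ) * nbodyQ ℓ u j (nbodyQ ℓ u i Φ) X).re

/-- `∫ g(x)ω(x) dx = ∫ v(1-ω)ω` (`g = v(1-ω)` (A.4)), the correction to `8πa` in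
`∬w₂ = ℓ³(8πa + ∫gω)` (2.10). [cite: Fournais2020, (2.10), (A.4)] -/
def gOmegaIntegral (v : ℝ → ℝ≥0∞) (ω : Space → ℝ) : ℝ≥0∞ :=
  ∫⁻ x : Space, v ‖x‖ * ENNReal.ofReal ((1 - ω x) * ω x)

/-! ### Named facts: (2.25) (Lemma 2.3) and Lemma 2.4 -/

/-- **Fournais 2020, (2.25)** (Lemma 2.3 = [FournaisSolovej2020, Lemma B.2] in the form used,
"using the identities (2.10) and `n₀ + n₊ = n`"). Let `v` satisfy Assumption 1.1 with scattering
solution `ω`, scattering length `a`, `supp v ⊂ B(0,R)`, and let the localisation function `χ`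
be given. There is a constant `C > 0` such that on the `n`-particle sector of the box `Λ` of
side `ℓ` (with `R/ℓ` small, so that `W, W₁` are well defined and `W₁ ≤ Cg`), for `ρ_μ > 0`,
`-ρ_μ∑ᵢ∫w₁(xᵢ,y)dy + ½∑_{i≠j}w(xᵢ,xⱼ) ≥ A₂ + (n²/(2ℓ³))(8πa + ∫gω dx) - (ρ_μ n/ℓ³ + ¼(ρ_μ - n/ℓ³)²)8πaℓ³ - Ca(ρ_μ + nℓ⁻³)(n₊ + 1)`
(2.25), `A₂ = ½∑_{i≠j}PᵢPⱼw₁(xᵢ,xⱼ)QⱼQᵢ + h.c.` (2.24), `n₊ = ∑Qᵢ` (2.15). Vendored as the real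
inequality between the expectations in a symmetric measurable `Φ` on `Λ(u)ⁿ` whose forms are
finite; `C, c₁` quantified after `v, ω, χ, R` (weakest reading; the printed `C` is universal).
[cite: Fournais2020, (2.25), Lemma 2.3 (2.22)–(2.24), Lemma 2.2 (2.16)–(2.21)]
[cite: FournaisSolovej2020, Lemma B.2] -/
def Fournais2020_eq225 : Prop :=
  ∀ (v : ℝ → ℝ≥0∞), IsRepulsiveFiniteRange v → (∫⁻ x : Space, v ‖x‖) ≠ ⊤ →
    0 < scatteringLength v →
  ∀ (ω : Space → ℝ), IsScatteringSolution v ω →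
  ∀ (χ : Space → ℝ), IsLocalizationFunction χ →
  ∀ (R : ℝ), 0 < R → (∀ r, R < r → v r = 0) →
  ∃ C c₁ : ℝ, 0 < C ∧ 0 < c₁ ∧
    ∀ (ℓ ρμ : ℝ), 0 < ℓ → 0 < ρμ → R ≤ c₁ * ℓ →
      let a := (scatteringLength v).toReal
      ∀ (n : ℕ) (u : Space) (Φ : Config n → ℂ), Measurable Φ →
        (∀ (σ : Equiv.Perm (Fin n)) (X : Config n), Φ (X ∘ σ) = Φ X) →
        (∫⁻ X in boxConfig n ℓ u, (‖Φ X‖₊ : ℝ≥0∞) ^ 2) ≠ ⊤ →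
        (∫⁻ X in boxConfig n ℓ u, repBoxN v χ ℓ u X * (‖Φ X‖₊ : ℝ≥0∞) ^ 2) ≠ ⊤ →
        (∫⁻ X in boxConfig n ℓ u, attrBoxN v ω χ ℓ ρμ u X * (‖Φ X‖₊ : ℝ≥0∞) ^ 2) ≠ ⊤ →
        nPlusBoxN ℓ u Φ ≠ ⊤ →
        a2Form v ω χ ℓ u Φ +
            ((n : ℝ) ^ 2 / (2 * ℓ ^ 3) * (8 * Real.pi * a + (gOmegaIntegral v ω).toReal) -
                (ρμ * n / ℓ ^ 3 + 4⁻¹ * (ρμ - n / ℓ ^ 3) ^ 2) * (8 * Real.pi * a * ℓ ^ 3)) *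
              (∫⁻ X in boxConfig n ℓ u, (‖Φ X‖₊ : ℝ≥0∞) ^ 2).toReal -
            C * a * (ρμ + n / ℓ ^ 3) *
              ((nPlusBoxN ℓ u Φ).toReal + (∫⁻ X in boxConfig n ℓ u, (‖Φ X‖₊ : ℝ≥0∞) ^ 2).toReal) ≤
          (∫⁻ X in boxConfig n ℓ u, repBoxN v χ ℓ u X * (‖Φ X‖₊ : ℝ≥0∞) ^ 2).toReal -
            (∫⁻ X in boxConfig n ℓ u, attrBoxN v ω χ ℓ ρμ u X * (‖Φ X‖₊ : ℝ≥0∞) ^ 2).toReal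

/-- **Fournais 2020, Lemma 2.4.** "On the `n`-particle sector, we have (with `T` from (2.6) and
`A₂` from Lemma 2.3)
`∑ᵢ(T^{(i)} - bℓ⁻²Qᵢ) + A₂ ≥ -(n(n+1)/(2ℓ³))∫g(x)ω(x)dx - Ca((n₀+1)/ℓ³)n₊ - Cnaℓ⁻³(1 + a²(n+1)²/ℓ² + (n+1)R²/ℓ²)`"
(2.26) — proved by second quantisation (2.27)–(2.42) ("see [FournaisSolovej2020, App. A] for
details" of the completion of the square (2.35)). Vendored as the real inequality between the
expectations in a symmetric measurable `Φ` on `Λ(u)ⁿ` whose forms are finite, with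
`∑ᵢT^{(i)} - bℓ⁻²n₊ = kinBoxN - bℓ⁻²·nPlusBoxN` and the (weaker) coefficient `(n+1)/ℓ³` in place
of `(n₀+1)/ℓ³` (`n₀ ≤ n`). The constant depends on `s` and `χ` ((2.37), (2.41)) and the estimate
needs `R/ℓ` small ((2.42)); `C, c₁` are quantified after `v, ω, χ, s, R` and before
`b, ℓ, n, u, Φ` (weakest reading). [cite: Fournais2020, Lemma 2.4 (2.26)–(2.42)]
[cite: FournaisSolovej2020, App. A] -/
def Fournais2020_lemma24 : Prop :=
  ∀ (v : ℝ → ℝ≥0∞), IsRepulsiveFiniteRange v → (∫⁻ x : Space, v ‖x‖) ≠ ⊤ →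
    0 < scatteringLength v →
  ∀ (ω : Space → ℝ), IsScatteringSolution v ω →
  ∀ (χ : Space → ℝ), IsLocalizationFunction χ →
  ∀ (s : ℝ), 0 < s →
  ∀ (R : ℝ), 0 < R → (∀ r, R < r → v r = 0) →
  ∃ C c₁ : ℝ, 0 < C ∧ 0 < c₁ ∧
    ∀ (b ℓ : ℝ), 0 < b → 0 < ℓ → R ≤ c₁ * ℓ →
      let a := (scatteringLength v).toReal
      ∀ (n : ℕ) (u : Space) (Φ : Config n → ℂ), Measurable Φ →
        (∀ (σ : Equiv.Perm (Fin n)) (X : Config n), Φ (X ∘ σ) = Φ X) →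
        (∫⁻ X in boxConfig n ℓ u, (‖Φ X‖₊ : ℝ≥0∞) ^ 2) ≠ ⊤ →
        (∫⁻ X in boxConfig n ℓ u, repBoxN v χ ℓ u X * (‖Φ X‖₊ : ℝ≥0∞) ^ 2) ≠ ⊤ →
        kinBoxN χ ℓ s b u Φ ≠ ⊤ →
        -((n : ℝ) * (n + 1) / (2 * ℓ ^ 3) * (gOmegaIntegral v ω).toReal *
              (∫⁻ X in boxConfig n ℓ u, (‖Φ X‖₊ : ℝ≥0∞) ^ 2).toReal) -
            C * a * ((n + 1) / ℓ ^ 3) * (nPlusBoxN ℓ u Φ).toReal -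
            C * n * a / ℓ ^ 3 * (1 + a ^ 2 * (n + 1) ^ 2 / ℓ ^ 2 + (n + 1) * R ^ 2 / ℓ ^ 2) *
              (∫⁻ X in boxConfig n ℓ u, (‖Φ X‖₊ : ℝ≥0∞) ^ 2).toReal ≤
          (kinBoxN χ ℓ s b u Φ).toReal - b / ℓ ^ 2 * (nPlusBoxN ℓ u Φ).toReal +
            a2Form v ω χ ℓ u Φ

/-! ### Basic API -/

/-- `PᵢΦ` does not depend on `xᵢ`. [cite: Fournais2020, (2.5)] -/
theorem nbodyP_update {n : ℕ} (ℓ : ℝ) (u : Space) (i : Fin n) (Φ : Config n → ℂ) (X : Config n)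
    (x : Space) : nbodyP ℓ u i Φ (Function.update X i x) = nbodyP ℓ u i Φ X := by
  simp [nbodyP, Function.update_idem]

/-- On `Λ(u)`, the one-body `Q_u` (3.5) of the `i`-th slice is `QᵢΦ` there:
`(Q_u Φ(X;·ᵢ))(x) = (QᵢΦ)(X; xᵢ = x)` for `x ∈ Λ(u)`. [cite: Fournais2020, (2.5), (3.5)] -/
theorem projQ_slice_eq_nbodyQ {n : ℕ} (ℓ : ℝ) (u : Space) (i : Fin n) (Φ : Config n → ℂ)
    (X : Config n) {x : Space} (hx : x ∈ slidingBox ℓ u) :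
    projQ ℓ u (fun y => Φ (Function.update X i y)) x = nbodyQ ℓ u i Φ (Function.update X i x) := by
  simp only [projQ, Set.indicator_of_mem hx, nbodyQ, nbodyP, Function.update_idem]

/-- `∫gω ≤ ∫g = 8πa` (`0 ≤ ω ≤ 1`). [cite: Fournais2020, (2.10), (A.2), (A.5)] -/
theorem gOmegaIntegral_le {v : ℝ → ℝ≥0∞} {ω : Space → ℝ} (h : IsScatteringSolution v ω) :
    gOmegaIntegral v ω ≤ ENNReal.ofReal (8 * Real.pi) * scatteringLength v := by
  rw [← h.lintegral_g]
  refine lintegral_mono fun x => mul_le_mul_right ?_ _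
  exact ENNReal.ofReal_le_ofReal (mul_le_of_le_one_right (by linarith [h.le_one x]) (h.le_one x))

end Literature.MathematicalPhysics.QuantumManyBody.BoseGas

end
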